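import Mathlib
import HarnessLib

/-!
# `DensityLadder.SeparatedTowerDensityLine` (item stmt-RiemannHypothesis-24918) — the zero sum is
# real under the conjugation involution

LINE L57 «sieve sight above the density line» (rh-idea-10 g1), crux K1 `SeparatedTowerDensityLine`
(stmt-RiemannHypothesis-24918), stub S1 `stub_separatedMeanValueCount` of the registered skeleton
`Birth.lean`.  First step of the mean-value argument: the hypothesis of K1 only controls the REAL
PART of the zero sum `S_η(x) = Σ_i m_i x^{ρ_i} ĉ_i(η)`, `ĉ_i(η) = ∫_{-1}^{1} φ(v)(1+ηv)^{ρ_i−1} dv`;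
the conjugation involution `σ` of the configuration (`ρ ∘ σ = conj ∘ ρ`, `m ∘ σ = m`) makes the sum
real, so `Re S = S` costs nothing (critic idea-crit-2: "conjugation symmetry makes the zero sum
real").  Here: `conj S_η(x) = S_η(x)` and `(S_η(x)).im = 0` for real `x > 0`, `0 < η ≤ 1/2`.
Cell rh-split, seat rh-split-prover-l57 g0.  RH-free, ζ-free; FRONTIER bookkeeping; nothing here
bears on the truth of RH.
-/

set_option linter.dupNamespace false

noncomputable section

open Complex Filter Set MeasureTheory Topology
open scoped Real ComplexConjugate

namespace Summit.RiemannHypothesis.RiemannHypothesis.Theorems.DensityLadderSeparatedTowerReal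

/-- The window transform conjugates with the zero: for real `0 < η ≤ 1/2`,
`conj ∫_{-1}^{1} φ(v)(1+ηv)^{ρ−1} dv = ∫_{-1}^{1} φ(v)(1+ηv)^{conj ρ − 1} dv`
(the base `1 + ηv > 0` is a positive real). [folklore] -/
theorem conj_windowTransform (φ : ℝ → ℝ) {η : ℝ} (hη : 0 < η) (hη1 : η ≤ 1 / 2) (ρ : ℂ) :
    conj (∫ v in (-1 : ℝ)..1, (φ v : ℂ) * ((1 : ℂ) + (η : ℂ) * (v : ℂ)) ^ (ρ - 1)) =
      ∫ v in (-1 : ℝ)..1, (φ v : ℂ) * ((1 : ℂ) + (η : ℂ) * (v : ℂ)) ^ (conj ρ - 1) := by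
  rw [← intervalIntegral.intervalIntegral_conj]
  refine intervalIntegral.integral_congr fun v hv ↦ ?_
  rw [uIcc_of_le (by norm_num), mem_Icc] at hv
  have hpos : 0 < 1 + η * v := by nlinarith
  have hb : ((1 : ℂ) + (η : ℂ) * (v : ℂ)) = ((1 + η * v : ℝ) : ℂ) := by push_cast; ring
  simp only [map_mul, Complex.conj_ofReal, hb]
  congr 1
  have harg : ((1 + η * v : ℝ) : ℂ).arg ≠ π := by
    rw [Complex.arg_ofReal_of_nonneg hpos.le]; exact Real.pi_pos.ne
  rw [← Complex.conj_ofReal (1 + η * v), Complex.conj_cpow _ _ harg, Complex.conj_ofReal]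
  simp

/-- `conj (x^ρ) = x^{conj ρ}` for a positive real base. [folklore] -/
theorem conj_ofReal_cpow {x : ℝ} (hx : 0 < x) (ρ : ℂ) :
    conj ((x : ℂ) ^ ρ) = (x : ℂ) ^ conj ρ := by
  have harg : (x : ℂ).arg ≠ π := by
    rw [Complex.arg_ofReal_of_nonneg hx.le]; exact Real.pi_pos.ne
  rw [← Complex.conj_ofReal x, Complex.conj_cpow _ _ harg, Complex.conj_ofReal]
  simp

/-- **The zero sum of a conjugation-symmetric configuration is real.**  If `σ` is an involution of
the index type with `ρ(σ i) = conj ρ(i)` and `m(σ i) = m(i)`, then for real `x > 0`,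
`0 < η ≤ 1/2`, `conj S = S` where `S = Σ'_i m_i · (x^{ρ_i} ∫_{-1}^{1} φ(v)(1+ηv)^{ρ_i−1} dv)`
(reindex the sum by `σ`; no summability needed, both sides being `0` together otherwise).
[folklore] -/
theorem conj_zeroSum_eq {ι : Type} (m : ι → ℝ) (ρ : ι → ℂ) (σ : ι → ι)
    (hσ : ∀ i, σ (σ i) = i ∧ ρ (σ i) = (starRingEnd ℂ) (ρ i) ∧ m (σ i) = m i)
    (φ : ℝ → ℝ) {η x : ℝ} (hη : 0 < η) (hη1 : η ≤ 1 / 2) (hx : 0 < x) :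
    conj (∑' i : ι, (m i : ℂ) * ((x : ℂ) ^ (ρ i) *
        ∫ v in (-1 : ℝ)..1, (φ v : ℂ) * ((1 : ℂ) + (η : ℂ) * (v : ℂ)) ^ (ρ i - 1))) =
      ∑' i : ι, (m i : ℂ) * ((x : ℂ) ^ (ρ i) *
        ∫ v in (-1 : ℝ)..1, (φ v : ℂ) * ((1 : ℂ) + (η : ℂ) * (v : ℂ)) ^ (ρ i - 1)) := by
  have hinv : Function.Involutive σ := fun i ↦ (hσ i).1
  -- termwise: `conj (f i) = f (σ i)`
  have hterm : ∀ i, conj ((m i : ℂ) * ((x : ℂ) ^ (ρ i) *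
      ∫ v in (-1 : ℝ)..1, (φ v : ℂ) * ((1 : ℂ) + (η : ℂ) * (v : ℂ)) ^ (ρ i - 1))) =
      (m (σ i) : ℂ) * ((x : ℂ) ^ (ρ (σ i)) *
        ∫ v in (-1 : ℝ)..1, (φ v : ℂ) * ((1 : ℂ) + (η : ℂ) * (v : ℂ)) ^ (ρ (σ i) - 1)) := by
    intro i
    rw [map_mul, map_mul, Complex.conj_ofReal, conj_ofReal_cpow hx, conj_windowTransform φ hη hη1,
      (hσ i).2.1, (hσ i).2.2]
  rw [Complex.conj_tsum]
  simp_rw [hterm]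
  exact Equiv.tsum_eq (hinv.toPerm σ) (fun i ↦ (m i : ℂ) * ((x : ℂ) ^ (ρ i) *
    ∫ v in (-1 : ℝ)..1, (φ v : ℂ) * ((1 : ℂ) + (η : ℂ) * (v : ℂ)) ^ (ρ i - 1)))

/-- Consequently the zero sum has vanishing imaginary part, i.e. it equals its real part.
[folklore] -/
theorem zeroSum_im_eq_zero {ι : Type} (m : ι → ℝ) (ρ : ι → ℂ) (σ : ι → ι)
    (hσ : ∀ i, σ (σ i) = i ∧ ρ (σ i) = (starRingEnd ℂ) (ρ i) ∧ m (σ i) = m i)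
    (φ : ℝ → ℝ) {η x : ℝ} (hη : 0 < η) (hη1 : η ≤ 1 / 2) (hx : 0 < x) :
    (∑' i : ι, (m i : ℂ) * ((x : ℂ) ^ (ρ i) *
        ∫ v in (-1 : ℝ)..1, (φ v : ℂ) * ((1 : ℂ) + (η : ℂ) * (v : ℂ)) ^ (ρ i - 1))).im = 0 := by
  have h := conj_zeroSum_eq m ρ σ hσ φ hη hη1 hx
  exact Complex.conj_eq_iff_im.1 h

/-- The same with the norm: `‖S‖ = |Re S|`. [folklore] -/
theorem norm_zeroSum_eq_abs_re {ι : Type} (m : ι → ℝ) (ρ : ι → ℂ) (σ : ι → ι)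
    (hσ : ∀ i, σ (σ i) = i ∧ ρ (σ i) = (starRingEnd ℂ) (ρ i) ∧ m (σ i) = m i)
    (φ : ℝ → ℝ) {η x : ℝ} (hη : 0 < η) (hη1 : η ≤ 1 / 2) (hx : 0 < x) :
    ‖∑' i : ι, (m i : ℂ) * ((x : ℂ) ^ (ρ i) *
        ∫ v in (-1 : ℝ)..1, (φ v : ℂ) * ((1 : ℂ) + (η : ℂ) * (v : ℂ)) ^ (ρ i - 1))‖ =
      |(∑' i : ι, (m i : ℂ) * ((x : ℂ) ^ (ρ i) *
        ∫ v in (-1 : ℝ)..1, (φ v : ℂ) * ((1 : ℂ) + (η : ℂ) * (v : ℂ)) ^ (ρ i - 1))).re| := by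
  have h := conj_zeroSum_eq m ρ σ hσ φ hη hη1 hx
  obtain ⟨r, hr⟩ := Complex.conj_eq_iff_real.1 h
  rw [hr, Complex.norm_real, Complex.ofReal_re, Real.norm_eq_abs]

end Summit.RiemannHypothesis.RiemannHypothesis.Theorems.DensityLadderSeparatedTowerReal

end
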